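import Summits.AtomisticToContinuum.FouriersLaw.Theorems.BondHeatUncertaintyExtensiveSnapshotIrreversibilityCorrectorIntegrability
import Summits.AtomisticToContinuum.FouriersLaw.Theorems.BondHeatUncertaintySubdiffusiveBondHeatSiteEnergyDynkin
import Summits.AtomisticToContinuum.FouriersLaw.Theorems.PhononMeanFreePathIncoherentBoundedLeftEnergyDynkin
import Summits.AtomisticToContinuum.FouriersLaw.Theorems.PhononMeanFreePathIncoherentBoundedEnergyDynkin
import HarnessLib

/-!
# Crux `ExtensiveSnapshotIrreversibility` (stmt-AtomisticToContinuum-9121), line `clausius-budget-sound-window`: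
registered sub-goal `correctorFlipDefect_eq_bondKubo` — THE CUT IDENTITY (bond-freeness of the odd response)

For the McLennan corrector `w = ∫₀^∞ P_s g ds` of the source `g = (γ/2T²)(p_0² − p_{N−1}²)` and the Kubo corrector
`u_b = ∫₀^∞ P_s j_b ds` of ANY bond current `j_b` (`b + 1 < N`), equilibrium kernels at `T`:
`w − w∘Θ = −(1/T²)(u_b − u_b∘Θ)` pointwise — so `K_N = ½D(w) = D(u_b)/(2T⁴)` and the crux's N-uniform stub S4 is a
statement about the late odd forecast of ONE bond's heat (cards window-jensen-bond-heat / transported-heat-window /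
jensen-thouless-window; route OddSectorIrreversibility's corrector theory).

Proof (one even observable does it all). With BLR's left block energy `E = E_{≤b}` (`HardTether.leftEnergy`) and
the energy `H`: `L E = γ(T − p_0²) − j_b`, `L H = γ(T − p_0²) + γ(T − p_{N−1}²)`, so POINTWISE
`L H − 2 L E = γ(p_0² − p_{N−1}²) + 2 j_b = 2T² g + 2 j_b`. Dynkin for the polynomially growing `H`, `E`
(`pinnedChain_hamiltonian_dynkin`, `pinnedChain_leftEnergy_dynkin`: truncation + CEHR (3.4)) gives
`(P_r H − H) − 2(P_r E − E) = 2T² ∫₀ʳ P_s g + 2 ∫₀ʳ P_s j_b` at every point; as `r → ∞` the left side tends to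
`(μ_T(H) − H) − 2(μ_T(E) − E)` by (MIX), the right side to `2T² w + 2 u_b` (the Kubo integrals of the centred `g`,
`j_b` converge absolutely). The limit is EVEN in the momenta, whence `2T²(w − w∘Θ) + 2(u_b − u_b∘Θ) = 0`. The
helpers turn (MIX) (CEHR (2.5) at the weight `e^{ϑH}`, `ϑ = 1/(4T)`) into decay for `|f| ≤ M e^{ϑH}`,
`P_r f(z) → μ_T(f)`, local integrability of the slices `s ↦ P_s f(z)` and absolute convergence of centred Kubo
integrals (`corrector_window_of_decay`); (INV) is not used. References: Cuneo–Eckmann–Hairer–Rey-Bellet, EJP 23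
(2018), Thm 2.13 (3) eq. (2.5), §3 eq. (3.4); Bonetto–Lebowitz–Rey-Bellet 2000 §5.2 (energy balance); McLennan 1959.
-/
noncomputable section

namespace Summit.AtomisticToContinuum.FouriersLaw.Theorems.ExtensiveSnapshotIrreversibility.ClausiusBudget

open MeasureTheory ProbabilityTheory Filter Topology Set
open scoped ENNReal NNReal
open Literature.MathematicalPhysics.KineticTheory.HeatConduction
open Literature.MathematicalPhysics.KineticTheory.HeatConduction.HardTether (leftEnergy)
open Summit.AtomisticToContinuum.FouriersLaw.Theorems.SubdiffusiveBondHeat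
  (pinnedChain_measurable_integral_transitionKernel_time pinnedChain_isConfining)
open Summit.AtomisticToContinuum.FouriersLaw.Theorems.IncoherentBounded
  (pinnedChain_hamiltonian_dynkin pinnedChain_generator_hamiltonian pinnedChain_leftEnergy_dynkin
    pinnedChain_abs_generator_hamiltonian_le)
open Summit.AtomisticToContinuum.FouriersLaw.Theorems.BoundaryKubo.GibbsTtcf
  (contDiff_leftEnergy leftEnergy_nonneg leftEnergy_le_hamiltonian)

section Helpers
variable {N : ℕ} {ω₂ lam β γ T ϑ C c : ℝ}

/-- The left block energy `E_{≤i}` is even in the momenta (it depends on them through `p_k²` only). [folklore] -/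
theorem leftEnergy_neg_momentum (P : OscillatorChain) (N : ℕ) (i : Fin N) (x : PhaseSpace N) :
    leftEnergy P N i (x.1, -x.2) = leftEnergy P N i x := by
  simp [HardTether.leftEnergy]

variable (hω : 0 < ω₂) (hl : 0 < lam) (hβ : 0 < β) (hγ : 0 < γ) (hT : 0 < T) (hN : 0 < N) in
include hω hl hβ hγ hT hN in
/-- Continuous observables dominated by `M e^{ϑH}` (`0 < ϑ < 1/T`) are integrable for every equilibrium transition
probability `P_t(z, ·)` of the pinned chain (CEHR (3.4)). [cite: CuneoEckmannHairerReyBellet2018, §3 eq. (3.4)] -/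
theorem integrable_transitionKernel_of_le_exp (hϑ : 0 < ϑ) (hϑT : ϑ < 1 / T) {f : PhaseSpace N → ℝ}
    (hf : Continuous f) {M : ℝ}
    (hfM : ∀ y, |f y| ≤ M * Real.exp (ϑ * (pinnedChain ω₂ lam β γ).hamiltonian N y)) (t : ℝ≥0)
    (z : PhaseSpace N) : Integrable f ((pinnedChain ω₂ lam β γ).transitionKernel N T T t z) :=
  ((integrable_exp_mul_hamiltonian_transitionKernel hω hl hβ hγ hT hN hϑ hϑT t z).const_mul M).mono'
    hf.aestronglyMeasurable (Eventually.of_forall fun y => by rw [Real.norm_eq_abs]; exact hfM y)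

-- the mixing hypothesis (MIX) at one weight `e^{ϑH}` with constants `C, c` (CEHR (2.5))
variable (hmix : ∀ (z : PhaseSpace N) (t : ℝ≥0) (f : PhaseSpace N → ℝ), Continuous f →
  (∀ y, |f y| ≤ Real.exp (ϑ * (pinnedChain ω₂ lam β γ).hamiltonian N y)) →
  |(∫ y, f y ∂((pinnedChain ω₂ lam β γ).transitionKernel N T T t z)) -
      ∫ y, f y ∂((pinnedChain ω₂ lam β γ).gibbsMeasure N T)| ≤
    C * Real.exp (ϑ * (pinnedChain ω₂ lam β γ).hamiltonian N z) * Real.exp (-c * t))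
include hmix

/-- **Scaling of the mixing bound**: if `|P_t f(z) - μ_T(f)| ≤ C e^{ϑH(z)} e^{-ct}` for continuous `|f| ≤ e^{ϑH}`,
then for continuous `|f| ≤ M e^{ϑH}` (`M ≥ 0`) it holds with `M C` (apply it to `f/M`; `f = 0` if `M = 0`). [folklore] -/
theorem abs_act_sub_mean_le_of_mix {f : PhaseSpace N → ℝ} (hf : Continuous f) {M : ℝ} (hM : 0 ≤ M)
    (hfM : ∀ y, |f y| ≤ M * Real.exp (ϑ * (pinnedChain ω₂ lam β γ).hamiltonian N y))
    (z : PhaseSpace N) (t : ℝ≥0) :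
    |(∫ y, f y ∂((pinnedChain ω₂ lam β γ).transitionKernel N T T t z)) -
        ∫ y, f y ∂((pinnedChain ω₂ lam β γ).gibbsMeasure N T)| ≤
      M * C * Real.exp (ϑ * (pinnedChain ω₂ lam β γ).hamiltonian N z) * Real.exp (-c * t) := by
  rcases hM.eq_or_lt with hM0 | hMpos
  · have hf0 : ∀ y, f y = 0 := fun y => by
      have h := hfM y
      rw [← hM0, zero_mul] at h
      exact abs_nonpos_iff.1 h
    simp [hf0, ← hM0]
  · have h := hmix z t (fun y => f y / M) (hf.div_const M) (fun y => by
      rw [abs_div, abs_of_pos hMpos, div_le_iff₀ hMpos, mul_comm]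
      exact hfM y)
    rw [integral_div, integral_div, ← sub_div, abs_div, abs_of_pos hMpos, div_le_iff₀ hMpos] at h
    calc _ ≤ C * Real.exp (ϑ * (pinnedChain ω₂ lam β γ).hamiltonian N z) * Real.exp (-c * t) * M := h
      _ = _ := by ring

/-- **Mixing along real times.** Under the mixing bound, `P_{r⁺} f(z) → μ_T(f)` as `r → ∞` for continuous
`|f| ≤ M e^{ϑH}` (`c > 0`). [folklore] -/
theorem tendsto_act_of_mix (hc : 0 < c) {f : PhaseSpace N → ℝ} (hf : Continuous f) {M : ℝ} (hM : 0 ≤ M)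
    (hfM : ∀ y, |f y| ≤ M * Real.exp (ϑ * (pinnedChain ω₂ lam β γ).hamiltonian N y)) (z : PhaseSpace N) :
    Tendsto (fun r : ℝ => ∫ y, f y ∂((pinnedChain ω₂ lam β γ).transitionKernel N T T r.toNNReal z)) atTop
      (𝓝 (∫ y, f y ∂((pinnedChain ω₂ lam β γ).gibbsMeasure N T))) := by
  set K := M * C * Real.exp (ϑ * (pinnedChain ω₂ lam β γ).hamiltonian N z) with hK
  have h1 : Tendsto (fun r : ℝ => Real.exp (-(c * r))) atTop (𝓝 0) :=
    Real.tendsto_exp_neg_atTop_nhds_zero.comp (tendsto_id.const_mul_atTop hc)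
  have h2 : Tendsto (fun r : ℝ => K * Real.exp (-c * r)) atTop (𝓝 0) := by
    have h := h1.const_mul K
    rw [mul_zero] at h
    refine h.congr' (Eventually.of_forall fun r => ?_)
    show K * Real.exp (-(c * r)) = K * Real.exp (-c * r)
    rw [neg_mul]
  refine tendsto_sub_nhds_zero_iff.1 (squeeze_zero_norm' ?_ h2)
  filter_upwards [eventually_ge_atTop (0 : ℝ)] with r hr
  have h := abs_act_sub_mean_le_of_mix hmix hf hM hfM z r.toNNReal
  rwa [Real.coe_toNNReal r hr, ← Real.norm_eq_abs] at h

variable (hω : 0 < ω₂) (hl : 0 < lam) (hβ : 0 < β) (hγ : 0 < γ)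
include hω hl hβ hγ

/-- **Local integrability of the time slices**: under the mixing bound, for continuous `|f| ≤ M e^{ϑH}` the slice
`s ↦ P_{s⁺} f(z)` is bounded by `|μ_T(f)| + M C e^{ϑH(z)}` (`c ≥ 0`) and measurable. [folklore] -/
theorem intervalIntegrable_act_of_mix (hC : 0 ≤ C) (hc : 0 ≤ c) {f : PhaseSpace N → ℝ} (hf : Continuous f)
    {M : ℝ} (hM : 0 ≤ M) (hfM : ∀ y, |f y| ≤ M * Real.exp (ϑ * (pinnedChain ω₂ lam β γ).hamiltonian N y))
    (z : PhaseSpace N) (a b : ℝ) :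
    IntervalIntegrable (fun s : ℝ => ∫ y, f y ∂((pinnedChain ω₂ lam β γ).transitionKernel N T T s.toNNReal z))
      volume a b := by
  have hmeas : Measurable fun s : ℝ =>
      ∫ y, f y ∂((pinnedChain ω₂ lam β γ).transitionKernel N T T s.toNNReal z) :=
    pinnedChain_measurable_integral_transitionKernel_time hω hl.le hβ hγ T T hf.measurable z
  set K := |∫ y, f y ∂((pinnedChain ω₂ lam β γ).gibbsMeasure N T)| +
    M * C * Real.exp (ϑ * (pinnedChain ω₂ lam β γ).hamiltonian N z) with hK
  refine IntervalIntegrable.mono_fun' (g := fun _ => K) intervalIntegrable_const hmeas.aestronglyMeasurable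
    (Eventually.of_forall fun s => ?_)
  show ‖_‖ ≤ K
  have h := abs_act_sub_mean_le_of_mix hmix hf hM hfM z s.toNNReal
  have h1 : Real.exp (-c * (s.toNNReal : ℝ)) ≤ 1 :=
    Real.exp_le_one_iff.2 (by nlinarith [NNReal.coe_nonneg s.toNNReal])
  have h2 := mul_le_of_le_one_right (mul_nonneg (mul_nonneg hM hC) (Real.exp_pos
    (ϑ * (pinnedChain ω₂ lam β γ).hamiltonian N z)).le) h1
  have h3 := abs_sub_abs_le_abs_sub (∫ y, f y ∂((pinnedChain ω₂ lam β γ).transitionKernel N T T s.toNNReal z))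
    (∫ y, f y ∂((pinnedChain ω₂ lam β γ).gibbsMeasure N T))
  rw [Real.norm_eq_abs, hK]
  linarith

variable (hT : 0 < T) (hN : 0 < N)
include hT hN

/-- **The Kubo integral of a centred observable converges absolutely**: under the mixing bound at the weight
`e^{ϑH}` (`0 < ϑ`, `2ϑ < 1/T`), for continuous `|f| ≤ M e^{ϑH}` with `μ_T(f) = 0` the slice `s ↦ P_{s⁺} f(z)` is
integrable on `(0, ∞)` (it is `O(e^{-cs})`; `corrector_window_of_decay`). [folklore] -/
theorem integrableOn_kubo_of_mix (hϑ : 0 < ϑ) (h2ϑ : 2 * ϑ < 1 / T) (hC : 0 ≤ C) (hc : 0 < c)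
    {f : PhaseSpace N → ℝ} (hf : Continuous f) {M : ℝ} (hM : 0 ≤ M)
    (hfM : ∀ y, |f y| ≤ M * Real.exp (ϑ * (pinnedChain ω₂ lam β γ).hamiltonian N y))
    (hf0 : ∫ y, f y ∂((pinnedChain ω₂ lam β γ).gibbsMeasure N T) = 0) (z : PhaseSpace N) :
    IntegrableOn (fun s : ℝ => ∫ y, f y ∂((pinnedChain ω₂ lam β γ).transitionKernel N T T s.toNNReal z))
      (Ioi 0) := by
  have hdecay : ∀ (z : PhaseSpace N) (t : ℝ≥0),
      |∫ y, f y ∂((pinnedChain ω₂ lam β γ).transitionKernel N T T t z)| ≤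
        M * C * Real.exp (ϑ * (pinnedChain ω₂ lam β γ).hamiltonian N z) * Real.exp (-c * t) := fun z t => by
    have h := abs_act_sub_mean_le_of_mix hmix hf hM hfM z t
    rwa [hf0, sub_zero] at h
  exact (corrector_window_of_decay hω hl hβ hγ hT hN hϑ h2ϑ hM hC hc hf hfM hdecay _ rfl _ rfl _ rfl
    _ rfl).1 z

end Helpers

/-- **The even identity behind the cut identity.** For the pinned chain (`ω₂, lam, β, γ > 0`, `N ≥ 1`, both
baths at `T > 0`) satisfying (MIX), a bond `i` (`i + 1 < N`) and every `z`:
`2T² ∫₀^∞ P_s g(z) ds + 2 ∫₀^∞ P_s j_i(z) ds = (μ_T(H) − H(z)) − 2(μ_T(E_{≤i}) − E_{≤i}(z))`,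
`g = (γ/2T²)(p_0² − p_{N−1}²)`. Proof: `L H − 2 L E_{≤i} = 2T² g + 2 j_i` pointwise
(`pinnedChain_generator_hamiltonian`, `bondCurrent_add_generator_leftEnergy`); Dynkin for `H` and `E_{≤i}`
(`pinnedChain_hamiltonian_dynkin`, `pinnedChain_leftEnergy_dynkin`) gives the identity with `∫₀ʳ`, `P_r` for all
`r ≥ 0`; let `r → ∞`: (MIX) on the left (`|H|, |E_{≤i}| ≤ C₀ e^{H/4T}`), absolute convergence of the centred
Kubo integrals on the right (`μ_T(g) = 0` by `p_0 ↔ p_{N−1}`, `μ_T(j_i) = 0` by `p ↦ −p`).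
[cite: CuneoEckmannHairerReyBellet2018, Thm 2.13 (3) eq. (2.5) and §3 eq. (3.4)] -/
theorem two_mul_sq_mul_corrector_add_two_mul_kubo {ω₂ lam β γ T : ℝ} (hω : 0 < ω₂) (hl : 0 < lam) (hβ : 0 < β)
    (hγ : 0 < γ) (hT : 0 < T) {N : ℕ} (hN : 0 < N)
    (hMIX : ∀ ϑ : ℝ, 0 < ϑ → ϑ < 1 / T → ∃ C c : ℝ, 0 < C ∧ 0 < c ∧
        ∀ (z : PhaseSpace N) (t : ℝ≥0) (f : PhaseSpace N → ℝ), Continuous f →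
          (∀ y, |f y| ≤ Real.exp (ϑ * (pinnedChain ω₂ lam β γ).hamiltonian N y)) →
          |(∫ y, f y ∂((pinnedChain ω₂ lam β γ).transitionKernel N T T t z)) -
              ∫ y, f y ∂((pinnedChain ω₂ lam β γ).gibbsMeasure N T)| ≤
            C * Real.exp (ϑ * (pinnedChain ω₂ lam β γ).hamiltonian N z) * Real.exp (-c * t))
    (i : Fin N) (hi : i.val + 1 < N) (z : PhaseSpace N) :
    2 * T ^ 2 * (∫ s in Ioi (0 : ℝ), ∫ y, γ / (2 * T ^ 2) *
          (y.2 ⟨0, hN⟩ ^ 2 - y.2 ⟨N - 1, Nat.sub_lt hN one_pos⟩ ^ 2)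
        ∂((pinnedChain ω₂ lam β γ).transitionKernel N T T s.toNNReal z)) +
      2 * (∫ s in Ioi (0 : ℝ), ∫ y, (pinnedChain ω₂ lam β γ).bondCurrent N i y
        ∂((pinnedChain ω₂ lam β γ).transitionKernel N T T s.toNNReal z)) =
    ((∫ y, (pinnedChain ω₂ lam β γ).hamiltonian N y ∂((pinnedChain ω₂ lam β γ).gibbsMeasure N T)) -
        (pinnedChain ω₂ lam β γ).hamiltonian N z) -
      2 * ((∫ y, leftEnergy (pinnedChain ω₂ lam β γ) N i y ∂((pinnedChain ω₂ lam β γ).gibbsMeasure N T)) -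
        leftEnergy (pinnedChain ω₂ lam β γ) N i z) := by
  obtain ⟨N, rfl⟩ : ∃ n, N = n + 1 := ⟨N - 1, by omega⟩
  have hT0 : T ≠ 0 := hT.ne'
  set P := pinnedChain ω₂ lam β γ with hP
  set κ := P.transitionKernel (N + 1) T T with hκ
  set μT := P.gibbsMeasure (N + 1) T with hμT
  set H : PhaseSpace (N + 1) → ℝ := P.hamiltonian (N + 1) with hH
  set E : PhaseSpace (N + 1) → ℝ := leftEnergy P (N + 1) i with hE
  set j : PhaseSpace (N + 1) → ℝ := P.bondCurrent (N + 1) i with hj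
  haveI : ∀ t, IsMarkovKernel (κ t) := fun t =>
    pinnedChain_isMarkovKernel_transitionKernel hω hl.le hβ.le hγ.le (N + 1) T T t
  -- energy bounds and continuity
  have hconf : P.IsConfining := pinnedChain_isConfining hω hl.le hβ.le hγ.le
  have hH0 : ∀ y, 0 ≤ H y := fun y => pinnedChain_hamiltonian_nonneg hω.le hl.le hβ.le γ (N + 1) y
  have hE0 : ∀ y, 0 ≤ E y := leftEnergy_nonneg P hconf.U_nonneg hconf.V_nonneg (N + 1) i
  have hEH : ∀ y, E y ≤ H y := leftEnergy_le_hamiltonian P hconf.U_nonneg hconf.V_nonneg (N + 1) i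
  have hHc : Continuous H := pinnedChain_continuous_hamiltonian ω₂ lam β γ (N + 1)
  have hEc : Continuous E :=
    (contDiff_leftEnergy P (pinnedChain_contDiff_U ω₂ lam β γ (n := 0))
      (pinnedChain_contDiff_V ω₂ lam β γ (n := 0)) (N + 1) i).continuous
  have hjc : Continuous j := pinnedChain_continuous_bondCurrent ω₂ lam β γ (N + 1) i
  -- the weight `e^{ϑH}`, `ϑ = 1/(4T)`, and the mixing constants
  set ϑ : ℝ := 1 / (4 * T) with hϑ_def
  have hϑ : 0 < ϑ := by positivity
  have h2ϑ : 2 * ϑ < 1 / T := by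
    rw [hϑ_def, show (2 : ℝ) * (1 / (4 * T)) = 1 / T * (1 / 2) by ring]
    exact mul_lt_of_lt_one_right (by positivity) (by norm_num)
  have hϑT : ϑ < 1 / T := by linarith
  obtain ⟨C, c, hC, hc, hmix⟩ := hMIX ϑ hϑ hϑT
  set C₀ : ℝ := 2 * Real.exp ϑ / ϑ ^ 2 with hC₀_def
  have hC₀ : 0 ≤ C₀ := by positivity
  have hsq : ∀ y, (1 + H y) ^ 2 ≤ C₀ * Real.exp (ϑ * H y) := fun y => one_add_sq_le_exp (hH0 y) hϑ
  have hHexp : ∀ y, H y ≤ C₀ * Real.exp (ϑ * H y) := fun y =>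
    le_trans (by nlinarith [hH0 y]) (hsq y)
  -- the observables `g`, `LH`, `LE`
  set g : PhaseSpace (N + 1) → ℝ := fun y =>
    γ / (2 * T ^ 2) * (y.2 ⟨0, hN⟩ ^ 2 - y.2 ⟨N + 1 - 1, Nat.sub_lt hN one_pos⟩ ^ 2) with hg
  set ℓH : PhaseSpace (N + 1) → ℝ := fun y =>
    γ * ((T - y.2 ⟨0, hN⟩ ^ 2) + (T - y.2 ⟨N + 1 - 1, Nat.sub_lt hN one_pos⟩ ^ 2)) with hℓH
  set ℓE : PhaseSpace (N + 1) → ℝ := fun y => γ * (T - y.2 ⟨0, hN⟩ ^ 2) - j y with hℓE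
  have hgc : Continuous g := by rw [hg]; fun_prop
  have hℓHc : Continuous ℓH := by rw [hℓH]; fun_prop
  have hℓEc : Continuous ℓE := by
    rw [hℓE]
    exact (continuous_const.mul (continuous_const.sub
      (((continuous_apply _).comp continuous_snd).pow 2))).sub hjc
  have hpt : ∀ y, ℓH y - 2 * ℓE y = 2 * T ^ 2 * g y + 2 * j y := fun y => by
    simp only [hℓH, hℓE, hg]
    field_simp
    ring
  -- exponential domination of the observables
  have hgM : ∀ y, |g y| ≤ 4 * |γ / (2 * T ^ 2)| / ϑ * Real.exp (ϑ * H y) := fun y =>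
    abs_mul_sq_sub_sq_le_exp hω.le hl.le hβ.le γ _ hϑ _ _ y
  have hjM : ∀ y, |j y| ≤ (N + 1 : ℕ) * ((3 + β) / 2) * C₀ * Real.exp (ϑ * H y) := fun y => by
    calc |j y| ≤ (N + 1 : ℕ) * ((3 + β) / 2 * (1 + H y) ^ 2) :=
          pinnedChain_abs_bondCurrent_le hω.le hl.le hβ.le γ (N + 1) i y
      _ ≤ (N + 1 : ℕ) * ((3 + β) / 2 * (C₀ * Real.exp (ϑ * H y))) := by gcongr; exact hsq y
      _ = _ := by ring
  have hHM : ∀ y, |H y| ≤ C₀ * Real.exp (ϑ * H y) := fun y => (abs_of_nonneg (hH0 y)).le.trans (hHexp y)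
  have hEM : ∀ y, |E y| ≤ C₀ * Real.exp (ϑ * H y) := fun y => by
    rw [abs_of_nonneg (hE0 y)]; exact (hEH y).trans (hHexp y)
  have hℓHM : ∀ y, |ℓH y| ≤ γ * (2 * T + 4) * C₀ * Real.exp (ϑ * H y) := fun y => by
    have h := pinnedChain_abs_generator_hamiltonian_le hω.le hl.le hβ.le hγ.le hN hT.le y
    rw [pinnedChain_generator_hamiltonian hN] at h
    have h0 : 0 ≤ γ * (2 * T + 4) := by positivity
    calc |ℓH y| ≤ γ * (2 * T + 4) * (1 + H y) ^ 2 := h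
      _ ≤ γ * (2 * T + 4) * (C₀ * Real.exp (ϑ * H y)) := mul_le_mul_of_nonneg_left (hsq y) h0
      _ = _ := by ring
  have hℓEM : ∀ y, |ℓE y| ≤ (γ * (2 * T + 4) * C₀ + 2 * T ^ 2 * (4 * |γ / (2 * T ^ 2)| / ϑ) +
      2 * ((N + 1 : ℕ) * ((3 + β) / 2) * C₀)) / 2 * Real.exp (ϑ * H y) := fun y => by
    have h : ℓE y = (ℓH y - 2 * T ^ 2 * g y - 2 * j y) / 2 := by linarith [hpt y]
    have hT2 : |2 * T ^ 2 * g y| = 2 * T ^ 2 * |g y| := by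
      rw [abs_mul, abs_of_nonneg (by positivity : (0 : ℝ) ≤ 2 * T ^ 2)]
    have h2j : |2 * j y| = 2 * |j y| := by rw [abs_mul, abs_two]
    rw [h, abs_div, abs_two, div_mul_eq_mul_div]
    refine div_le_div_of_nonneg_right ?_ two_pos.le
    calc |ℓH y - 2 * T ^ 2 * g y - 2 * j y| ≤ |ℓH y| + |2 * T ^ 2 * g y| + |2 * j y| := by
          have := abs_sub (ℓH y - 2 * T ^ 2 * g y) (2 * j y)
          have := abs_sub (ℓH y) (2 * T ^ 2 * g y)
          linarith
      _ ≤ γ * (2 * T + 4) * C₀ * Real.exp (ϑ * H y) + 2 * T ^ 2 * (4 * |γ / (2 * T ^ 2)| / ϑ *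
            Real.exp (ϑ * H y)) + 2 * ((N + 1 : ℕ) * ((3 + β) / 2) * C₀ * Real.exp (ϑ * H y)) := by
          rw [hT2, h2j]
          exact add_le_add (add_le_add (hℓHM y) (mul_le_mul_of_nonneg_left (hgM y) (by positivity)))
            (mul_le_mul_of_nonneg_left (hjM y) two_pos.le)
      _ = _ := by ring
  -- time slices at the point `z`
  set aH : ℝ → ℝ := fun s => ∫ y, ℓH y ∂(κ s.toNNReal z) with haH
  set aE : ℝ → ℝ := fun s => ∫ y, ℓE y ∂(κ s.toNNReal z) with haE
  set ag : ℝ → ℝ := fun s => ∫ y, g y ∂(κ s.toNNReal z) with hag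
  set aj : ℝ → ℝ := fun s => ∫ y, j y ∂(κ s.toNNReal z) with haj
  -- Dynkin's identity for `H` and `E_{≤i}`
  have hdynH : ∀ r : ℝ≥0, (∫ y, H y ∂(κ r z)) - H z = ∫ s in (0 : ℝ)..(r : ℝ), aH s := fun r => by
    simpa only [pinnedChain_generator_hamiltonian hN] using pinnedChain_hamiltonian_dynkin hω hl.le hβ hγ hN hT r z
  have hdynE : ∀ r : ℝ≥0, (∫ y, E y ∂(κ r z)) - E z = ∫ s in (0 : ℝ)..(r : ℝ), aE s := fun r =>
    pinnedChain_leftEnergy_dynkin hω hl.le hβ hγ hT hi r z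
  -- mixing: `P_r H(z) → μ_T(H)`, `P_r E(z) → μ_T(E)`
  have hlimH : Tendsto (fun r : ℝ => ∫ y, H y ∂(κ r.toNNReal z)) atTop (𝓝 (∫ y, H y ∂μT)) :=
    tendsto_act_of_mix hmix hc hHc hC₀ hHM z
  have hlimE : Tendsto (fun r : ℝ => ∫ y, E y ∂(κ r.toNNReal z)) atTop (𝓝 (∫ y, E y ∂μT)) :=
    tendsto_act_of_mix hmix hc hEc hC₀ hEM z
  -- Kubo: the centred `g`, `j` have absolutely convergent Kubo integrals, `∫₀ʳ → ∫₀^∞`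
  have hg0 : ∫ y, g y ∂μT = 0 := integral_sq_sub_sq_gibbsMeasure ω₂ lam β γ _ T _ _
  have hj0 : ∫ y, j y ∂μT = 0 := pinnedChain_integral_bondCurrent_gibbsMeasure ω₂ lam β γ (N + 1) T i
  have hlimg : Tendsto (fun r : ℝ => ∫ s in (0 : ℝ)..r, ag s) atTop (𝓝 (∫ s in Ioi (0 : ℝ), ag s)) :=
    intervalIntegral_tendsto_integral_Ioi 0 (integrableOn_kubo_of_mix hmix hω hl hβ hγ hT hN hϑ h2ϑ hC.le hc
      hgc (by positivity) hgM hg0 z) tendsto_id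
  have hlimj : Tendsto (fun r : ℝ => ∫ s in (0 : ℝ)..r, aj s) atTop (𝓝 (∫ s in Ioi (0 : ℝ), aj s)) :=
    intervalIntegral_tendsto_integral_Ioi 0 (integrableOn_kubo_of_mix hmix hω hl hβ hγ hT hN hϑ h2ϑ hC.le hc
      hjc (by positivity) hjM hj0 z) tendsto_id
  -- local integrability of the four slices
  have hIIH : ∀ r : ℝ, IntervalIntegrable aH volume 0 r := fun r =>
    intervalIntegrable_act_of_mix hmix hω hl hβ hγ hC.le hc.le hℓHc (by positivity) hℓHM z 0 r
  have hIIE : ∀ r : ℝ, IntervalIntegrable aE volume 0 r := fun r =>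
    intervalIntegrable_act_of_mix hmix hω hl hβ hγ hC.le hc.le hℓEc (by positivity) hℓEM z 0 r
  have hIIg : ∀ r : ℝ, IntervalIntegrable ag volume 0 r := fun r =>
    intervalIntegrable_act_of_mix hmix hω hl hβ hγ hC.le hc.le hgc (by positivity) hgM z 0 r
  have hIIj : ∀ r : ℝ, IntervalIntegrable aj volume 0 r := fun r =>
    intervalIntegrable_act_of_mix hmix hω hl hβ hγ hC.le hc.le hjc (by positivity) hjM z 0 r
  -- the pointwise identity `LH - 2 LE = 2T² g + 2 j`, sliced
  have hslice : ∀ s : ℝ, aH s - 2 * aE s = 2 * T ^ 2 * ag s + 2 * aj s := fun s => by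
    have hintH := integrable_transitionKernel_of_le_exp hω hl hβ hγ hT hN hϑ hϑT hℓHc hℓHM s.toNNReal z
    have hintE := integrable_transitionKernel_of_le_exp hω hl hβ hγ hT hN hϑ hϑT hℓEc hℓEM s.toNNReal z
    have hintg := integrable_transitionKernel_of_le_exp hω hl hβ hγ hT hN hϑ hϑT hgc hgM s.toNNReal z
    have hintj := integrable_transitionKernel_of_le_exp hω hl hβ hγ hT hN hϑ hϑT hjc hjM s.toNNReal z
    have hL : ∫ y, (ℓH y - 2 * ℓE y) ∂(κ s.toNNReal z) = aH s - 2 * aE s := by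
      rw [integral_sub hintH (hintE.const_mul 2), integral_const_mul 2 ℓE]
    have hR : ∫ y, (2 * T ^ 2 * g y + 2 * j y) ∂(κ s.toNNReal z) = 2 * T ^ 2 * ag s + 2 * aj s := by
      rw [integral_add (hintg.const_mul _) (hintj.const_mul _), integral_const_mul (2 * T ^ 2) g,
        integral_const_mul 2 j]
    rw [← hL, ← hR]
    exact integral_congr_ae (Eventually.of_forall hpt)
  -- Dynkin, combined: for `r ≥ 0`
  have hId : ∀ r : ℝ, 0 ≤ r →
      ((∫ y, H y ∂(κ r.toNNReal z)) - H z) - 2 * ((∫ y, E y ∂(κ r.toNNReal z)) - E z) =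
        2 * T ^ 2 * (∫ s in (0 : ℝ)..r, ag s) + 2 * ∫ s in (0 : ℝ)..r, aj s := by
    intro r hr
    have h1 := hdynH r.toNNReal
    have h2 := hdynE r.toNNReal
    rw [Real.coe_toNNReal r hr] at h1 h2
    have eq1 : ∫ s in (0 : ℝ)..r, (aH s - 2 * aE s) =
        (∫ s in (0 : ℝ)..r, aH s) - 2 * ∫ s in (0 : ℝ)..r, aE s := by
      rw [intervalIntegral.integral_sub (hIIH r) ((hIIE r).const_mul 2), intervalIntegral.integral_const_mul 2 aE]
    have eq2 : ∫ s in (0 : ℝ)..r, (aH s - 2 * aE s) = ∫ s in (0 : ℝ)..r, (2 * T ^ 2 * ag s + 2 * aj s) :=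
      intervalIntegral.integral_congr fun s _ => hslice s
    have eq3 : ∫ s in (0 : ℝ)..r, (2 * T ^ 2 * ag s + 2 * aj s) =
        2 * T ^ 2 * (∫ s in (0 : ℝ)..r, ag s) + 2 * ∫ s in (0 : ℝ)..r, aj s := by
      rw [intervalIntegral.integral_add ((hIIg r).const_mul _) ((hIIj r).const_mul _),
        intervalIntegral.integral_const_mul (2 * T ^ 2) ag, intervalIntegral.integral_const_mul 2 aj]
    rw [h1, h2]
    linarith
  -- pass to the limit `r → ∞`
  have hF : Tendsto (fun r : ℝ => ((∫ y, H y ∂(κ r.toNNReal z)) - H z) -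
      2 * ((∫ y, E y ∂(κ r.toNNReal z)) - E z)) atTop
      (𝓝 (((∫ y, H y ∂μT) - H z) - 2 * ((∫ y, E y ∂μT) - E z))) :=
    (hlimH.sub_const (H z)).sub ((hlimE.sub_const (E z)).const_mul 2)
  have hG : Tendsto (fun r : ℝ => 2 * T ^ 2 * (∫ s in (0 : ℝ)..r, ag s) + 2 * ∫ s in (0 : ℝ)..r, aj s) atTop
      (𝓝 (2 * T ^ 2 * (∫ s in Ioi (0 : ℝ), ag s) + 2 * ∫ s in Ioi (0 : ℝ), aj s)) :=
    (hlimg.const_mul _).add (hlimj.const_mul _)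
  have hFG := hF.congr'
    (f₂ := fun r : ℝ => 2 * T ^ 2 * (∫ s in (0 : ℝ)..r, ag s) + 2 * ∫ s in (0 : ℝ)..r, aj s)
    (by filter_upwards [eventually_ge_atTop (0 : ℝ)] with r hr using hId r hr)
  show 2 * T ^ 2 * (∫ s in Ioi (0 : ℝ), ag s) + 2 * (∫ s in Ioi (0 : ℝ), aj s) =
    ((∫ y, H y ∂μT) - H z) - 2 * ((∫ y, E y ∂μT) - E z)
  exact tendsto_nhds_unique hG hFG

/-- **The cut identity (bond-freeness of the odd response)** — registered sub-goal `correctorFlipDefect_eq_bondKubo`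
of line `clausius-budget-sound-window`, crux `ExtensiveSnapshotIrreversibility` (stmt-AtomisticToContinuum-9121).
For the pinned chain `P = pinnedChain ω₂ lam β γ` (`ω₂, lam, β, γ > 0`, `N ≥ 2`, both baths at `T > 0`; kernels
`P_t = P.transitionKernel N T T t`, Gibbs state `μ_T`), ASSUME (INV) `μ_T P_t = μ_T` (not used) and (MIX) = CEHR
(2.5): for `0 < ϑ < 1/T` there are `C, c > 0` with `|P_t f(z) - μ_T(f)| ≤ C e^{ϑH(z)} e^{-ct}` for continuous
`|f| ≤ e^{ϑH}`. With the McLennan corrector `w z = ∫_{(0,∞)} P_{s⁺} g(z) ds`, `g = (γ/2T²)(p_0² − p_{N−1}²)`, and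
the Kubo corrector `u_b z = ∫_{(0,∞)} P_{s⁺} j_b(z) ds` of ANY bond current `j_b = P.bondCurrent N b` (`b + 1 < N`):
`w z − w (z.1, −z.2) = −(1/T²) (u_b z − u_b (z.1, −z.2))` for EVERY `z`. Proof: by
`two_mul_sq_mul_corrector_add_two_mul_kubo`, `2T² w + 2 u_b = (μ_T(H) − H) − 2(μ_T(E_{≤b}) − E_{≤b})` pointwise;
the right side is even in `p` (`hamiltonian_neg_momentum`, `leftEnergy_neg_momentum`); subtract the identity at `z`
from the one at `(z.1, −z.2)`. [cite: CuneoEckmannHairerReyBellet2018, Thm 2.13 (3) eq. (2.5) and §3 eq. (3.4)] -/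
theorem correctorFlipDefect_eq_bondKubo :
    ∀ ω₂ lam β γ : ℝ, 0 < ω₂ → 0 < lam → 0 < β → 0 < γ → ∀ T : ℝ, 0 < T → ∀ (N : ℕ) (hN : 2 ≤ N),
      let P := pinnedChain ω₂ lam β γ
      let μT := P.gibbsMeasure N T
      (∀ t : ℝ≥0, μT.bind (P.transitionKernel N T T t) = μT) →
      (∀ ϑ : ℝ, 0 < ϑ → ϑ < 1 / T → ∃ C c : ℝ, 0 < C ∧ 0 < c ∧
        ∀ (z : PhaseSpace N) (t : ℝ≥0) (f : PhaseSpace N → ℝ), Continuous f →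
          (∀ y, |f y| ≤ Real.exp (ϑ * P.hamiltonian N y)) →
          |(∫ y, f y ∂(P.transitionKernel N T T t z)) - ∫ y, f y ∂μT| ≤
            C * Real.exp (ϑ * P.hamiltonian N z) * Real.exp (-c * t)) →
      let g : PhaseSpace N → ℝ := fun y =>
        γ / (2 * T ^ 2) * (y.2 ⟨0, by omega⟩ ^ 2 - y.2 ⟨N - 1, by omega⟩ ^ 2)
      let Pg : ℝ → PhaseSpace N → ℝ := fun s z => ∫ y, g y ∂(P.transitionKernel N T T s.toNNReal z)
      let w : PhaseSpace N → ℝ := fun z => ∫ s in Set.Ioi (0 : ℝ), Pg s z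
      ∀ (b : ℕ) (hb : b + 1 < N),
        let ub : PhaseSpace N → ℝ := fun z =>
          ∫ s in Set.Ioi (0 : ℝ), ∫ y, P.bondCurrent N ⟨b, by omega⟩ y ∂(P.transitionKernel N T T s.toNNReal z)
        ∀ z : PhaseSpace N, w z - w (z.1, -z.2) = -(1 / T ^ 2) * (ub z - ub (z.1, -z.2)) := by
  intro ω₂ lam β γ hω hl hβ hγ T hT N hN P μT _hINV hMIX g Pg w b hb ub z
  have hN0 : 0 < N := by omega
  have h1 := two_mul_sq_mul_corrector_add_two_mul_kubo hω hl hβ hγ hT hN0 hMIX ⟨b, by omega⟩ hb z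
  have h2 := two_mul_sq_mul_corrector_add_two_mul_kubo hω hl hβ hγ hT hN0 hMIX ⟨b, by omega⟩ hb (z.1, -z.2)
  rw [OscillatorChain.hamiltonian_neg_momentum, leftEnergy_neg_momentum] at h2
  have e1 : 2 * T ^ 2 * w z + 2 * ub z = _ := h1
  have e2 : 2 * T ^ 2 * w (z.1, -z.2) + 2 * ub (z.1, -z.2) = _ := h2
  have key : 2 * T ^ 2 * (w z - w (z.1, -z.2)) = -(2 * (ub z - ub (z.1, -z.2))) := by linarith
  have hT2 : (T ^ 2 : ℝ) ≠ 0 := by positivity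
  field_simp
  linarith

end Summit.AtomisticToContinuum.FouriersLaw.Theorems.ExtensiveSnapshotIrreversibility.ClausiusBudget

end
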